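import Summits.CriticalPhenomena.PercolationContinuityZ3.Theorems.PercNearOneGluingNoHeavyLowerTailKNGoodGCThreeHairMove
import Summits.CriticalPhenomena.PercolationContinuityZ3.Theorems.PercNearOneGluingNoHeavyLowerTailKNGoodGCThreeKillTwin
import HarnessLib

/-!
# The glued two-star observer is a merged one-star observer
# (`NoHeavyLowerTail` cell, stmt-CriticalPhenomena-4575; prover `prim-hp-2`, deletion–contraction line, gen 12)

Support file (`--supports stmt-CriticalPhenomena-4575`).  No definitions, no named facts, no sorries.
Memo: `run/shared/lean/prim/prim-hp-2/MEMO-gen12-gc-three-relays.md` §7 (phases 1–2 of the three-relay GC assembly).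

* `KNGoodGC3.mergedStar_exists` — for two pendant stars `x, y` with ports in `{a₁,a₂,a₃}` there is a weight function `N` (three hair moves
  `agood_moveHair_twin`, then `agood_kill_pendantTwin`) with `agood(u[s(x,y)↦1], x; j) = agood(N, x; j)`, in which `x` is a one-layer observer
  with ports `a₁,a₂,a₃` and hairs `x_i + y_i − x_i y_i`, and whose core (`x` killed) is `u` with `x, y` killed.
[cite: KozmaNitzan2024, §3.2 Definition (p. 12), proof of Thm. 5 (pp. 13–14); folklore]
-/

noncomputable section

namespace Summit.CriticalPhenomena.PercolationContinuityZ3.Theorems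

open MeasureTheory Set Literature.Probability.LatticeModels Literature.Probability.Percolation
open scoped Classical BigOperators

variable {n : ℕ}

namespace KNGoodGC3

open ChampionStability KNGoodAux KNGoodHair KNGoodSeries KNGoodPortFree

/-- **The merged star, packaged.**  For two pendant stars `x, y` into `{a₁,a₂,a₃}` there is a weight function `N` (the three hair moves
followed by killing `y`) such that: the goodness functional of the glued observer equals that of `N` at `x`; in `N`, `x` is a one-layer
observer with ports `a₁,a₂,a₃` and hairs `x_i + y_i − x_i y_i`; and `N` with `x` killed is the core `u` with `x, y` killed.
[cite: KozmaNitzan2024, §3.2 Definition (p. 12), proof of Thm. 5 (pp. 13–14); folklore] -/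
theorem mergedStar_exists (u : Sym2 (Fin n) → unitInterval) (A : Finset (Fin n)) (hA : A.Nonempty)
    (x y b a₁ a₂ a₃ j : Fin n) (hxy : x ≠ y) (hxa₁ : x ≠ a₁) (hxa₂ : x ≠ a₂) (hxa₃ : x ≠ a₃)
    (hya₁ : y ≠ a₁) (hya₂ : y ≠ a₂) (hya₃ : y ≠ a₃) (h12 : a₁ ≠ a₂) (h13 : a₁ ≠ a₃) (h23 : a₂ ≠ a₃)
    (hyA : y ∉ A) (hjA : j ∈ A) (hby : b ≠ y)
    (hxN : ∀ z : Fin n, z ≠ a₁ → z ≠ a₂ → z ≠ a₃ → u s(x, z) = 0)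
    (hyN : ∀ z : Fin n, z ≠ a₁ → z ≠ a₂ → z ≠ a₃ → u s(y, z) = 0) :
    ∃ N : Sym2 (Fin n) → unitInterval,
      ((prodBernoulli (Function.update u s(x, y) 1)).real (openConn x b) -
            (prodBernoulli (Function.update u s(x, y) 1)).real (openConn j b) +
          ∑ W ∈ nullSets A, (prodBernoulli (Function.update u s(x, y) 1)).real (clusterIs x W) *
            A.inf' hA (fun a' => (prodBernoulli (Function.update u s(x, y) 1)).real (openConnIn ((↑W : Set (Fin n))ᶜ) a' b)) =
        (prodBernoulli N).real (openConn x b) - (prodBernoulli N).real (openConn j b) +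
          ∑ W ∈ nullSets A, (prodBernoulli N).real (clusterIs x W) *
            A.inf' hA (fun a' => (prodBernoulli N).real (openConnIn ((↑W : Set (Fin n))ᶜ) a' b))) ∧
      (∀ z : Fin n, z ≠ x → z ∉ ({a₁, a₂, a₃} : Finset (Fin n)) → N s(x, z) = 0) ∧ N s(x, x) = 0 ∧
      ((N s(x, a₁) : ℝ) = u s(x, a₁) + u s(y, a₁) - u s(x, a₁) * u s(y, a₁)) ∧
      ((N s(x, a₂) : ℝ) = u s(x, a₂) + u s(y, a₂) - u s(x, a₂) * u s(y, a₂)) ∧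
      ((N s(x, a₃) : ℝ) = u s(x, a₃) + u s(y, a₃) - u s(x, a₃) * u s(y, a₃)) ∧
      (fun e : Sym2 (Fin n) => if x ∈ e then (0 : unitInterval) else N e) =
        fun e => if x ∈ e then (0 : unitInterval) else if y ∈ e then 0 else u e := by
  -- pair bookkeeping
  have kxy : ∀ c d : Fin n, x ≠ d → s(x, c) ≠ s(y, d) := by
    intro c d hxd h
    rcases Sym2.eq_iff.1 h with ⟨h1, _⟩ | ⟨h1, _⟩
    · exact hxy h1
    · exact hxd h1
  have kxx : ∀ c d : Fin n, c ≠ d → s(x, c) ≠ s(x, d) := fun c d hcd h => hcd (Sym2.congr_right.1 h)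
  have kyy : ∀ c d : Fin n, c ≠ d → s(y, c) ≠ s(y, d) := fun c d hcd h => hcd (Sym2.congr_right.1 h)
  have kyx : ∀ c d : Fin n, y ≠ d → s(y, c) ≠ s(x, d) := by
    intro c d hyd h
    rcases Sym2.eq_iff.1 h with ⟨h1, _⟩ | ⟨h1, _⟩
    · exact hxy h1.symm
    · exact hyd h1
  have kyxy : ∀ c : Fin n, c ≠ x → s(y, c) ≠ s(x, y) := by
    intro c hc h
    rcases Sym2.eq_iff.1 h with ⟨h1, _⟩ | ⟨_, h2⟩
    · exact hxy h1.symm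
    · exact hc h2
  -- the chain of weight functions
  set v₀ : Sym2 (Fin n) → unitInterval := Function.update u s(x, y) 1 with hv₀
  set v₁ : Sym2 (Fin n) → unitInterval := Function.update (Function.update v₀ s(y, a₁) 0) s(x, a₁)
    ⟨(v₀ s(x, a₁) : ℝ) + v₀ s(y, a₁) - v₀ s(x, a₁) * v₀ s(y, a₁), mergeHair_mem (v₀ s(x, a₁)) (v₀ s(y, a₁))⟩ with hv₁
  set v₂ : Sym2 (Fin n) → unitInterval := Function.update (Function.update v₁ s(y, a₂) 0) s(x, a₂)
    ⟨(v₁ s(x, a₂) : ℝ) + v₁ s(y, a₂) - v₁ s(x, a₂) * v₁ s(y, a₂), mergeHair_mem (v₁ s(x, a₂)) (v₁ s(y, a₂))⟩ with hv₂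
  set v₃ : Sym2 (Fin n) → unitInterval := Function.update (Function.update v₂ s(y, a₃) 0) s(x, a₃)
    ⟨(v₂ s(x, a₃) : ℝ) + v₂ s(y, a₃) - v₂ s(x, a₃) * v₂ s(y, a₃), mergeHair_mem (v₂ s(x, a₃)) (v₂ s(y, a₃))⟩ with hv₃
  set F : Set (Sym2 (Fin n)) := {e : Sym2 (Fin n) | y ∈ e ∧ ¬ e.IsDiag} with hF
  set N : Sym2 (Fin n) → unitInterval := pinW v₃ F ∅ with hN
  -- generic evaluation off the updated keys
  have ev₁ : ∀ e : Sym2 (Fin n), e ≠ s(y, a₁) → e ≠ s(x, a₁) → v₁ e = v₀ e := by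
    intro e h1 h2; rw [hv₁, Function.update_of_ne h2, Function.update_of_ne h1]
  have ev₂ : ∀ e : Sym2 (Fin n), e ≠ s(y, a₂) → e ≠ s(x, a₂) → v₂ e = v₁ e := by
    intro e h1 h2; rw [hv₂, Function.update_of_ne h2, Function.update_of_ne h1]
  have ev₃ : ∀ e : Sym2 (Fin n), e ≠ s(y, a₃) → e ≠ s(x, a₃) → v₃ e = v₂ e := by
    intro e h1 h2; rw [hv₃, Function.update_of_ne h2, Function.update_of_ne h1]
  have ev₀ : ∀ e : Sym2 (Fin n), e ≠ s(x, y) → v₀ e = u e := by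
    intro e h; rw [hv₀, Function.update_of_ne h]
  have evN : ∀ e : Sym2 (Fin n), y ∉ e → N e = v₃ e := by
    intro e hy; rw [hN]; exact pinW_apply_of_not_mem v₃ ∅ (fun h => hy h.1)
  -- u-values along the chain
  have ux : ∀ c : Fin n, c ≠ y → v₀ s(x, c) = u s(x, c) := fun c hc => ev₀ _ (kxx c y hc)
  have uy : ∀ c : Fin n, c ≠ x → v₀ s(y, c) = u s(y, c) := fun c hc => ev₀ _ (kyxy c hc)
  have w1x2 : v₁ s(x, a₂) = u s(x, a₂) := by rw [ev₁ _ (kxy a₂ a₁ hxa₁) (kxx a₂ a₁ h12.symm), ux a₂ hya₂.symm]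
  have w1y2 : v₁ s(y, a₂) = u s(y, a₂) := by rw [ev₁ _ (kyy a₂ a₁ h12.symm) (kyx a₂ a₁ hya₁), uy a₂ hxa₂.symm]
  have w1x3 : v₁ s(x, a₃) = u s(x, a₃) := by rw [ev₁ _ (kxy a₃ a₁ hxa₁) (kxx a₃ a₁ h13.symm), ux a₃ hya₃.symm]
  have w1y3 : v₁ s(y, a₃) = u s(y, a₃) := by rw [ev₁ _ (kyy a₃ a₁ h13.symm) (kyx a₃ a₁ hya₁), uy a₃ hxa₃.symm]
  have w2x3 : v₂ s(x, a₃) = u s(x, a₃) := by rw [ev₂ _ (kxy a₃ a₂ hxa₂) (kxx a₃ a₂ h23.symm), w1x3]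
  have w2y3 : v₂ s(y, a₃) = u s(y, a₃) := by rw [ev₂ _ (kyy a₃ a₂ h23.symm) (kyx a₃ a₂ hya₂), w1y3]
  -- the three merged hairs
  have m1 : ((v₁ s(x, a₁) : unitInterval) : ℝ) = u s(x, a₁) + u s(y, a₁) - u s(x, a₁) * u s(y, a₁) := by
    rw [hv₁, Function.update_self]; simp only
    rw [ux a₁ hya₁.symm, uy a₁ hxa₁.symm]
  have m2 : ((v₂ s(x, a₂) : unitInterval) : ℝ) = u s(x, a₂) + u s(y, a₂) - u s(x, a₂) * u s(y, a₂) := by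
    rw [hv₂, Function.update_self]; simp only
    rw [w1x2, w1y2]
  have m3 : ((v₃ s(x, a₃) : unitInterval) : ℝ) = u s(x, a₃) + u s(y, a₃) - u s(x, a₃) * u s(y, a₃) := by
    rw [hv₃, Function.update_self]; simp only
    rw [w2x3, w2y3]
  have nyx : ∀ c : Fin n, c ≠ y → y ∉ s(x, c) := by
    intro c hc h; rcases Sym2.mem_iff.1 h with h | h
    · exact hxy h.symm
    · exact hc h.symm
  have hN1 : ((N s(x, a₁) : unitInterval) : ℝ) = u s(x, a₁) + u s(y, a₁) - u s(x, a₁) * u s(y, a₁) := by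
    rw [evN _ (nyx a₁ hya₁.symm), ev₃ _ (kxy a₁ a₃ hxa₃) (kxx a₁ a₃ h13), ev₂ _ (kxy a₁ a₂ hxa₂) (kxx a₁ a₂ h12), m1]
  have hN2 : ((N s(x, a₂) : unitInterval) : ℝ) = u s(x, a₂) + u s(y, a₂) - u s(x, a₂) * u s(y, a₂) := by
    rw [evN _ (nyx a₂ hya₂.symm), ev₃ _ (kxy a₂ a₃ hxa₃) (kxx a₂ a₃ h23), m2]
  have hN3 : ((N s(x, a₃) : unitInterval) : ℝ) = u s(x, a₃) + u s(y, a₃) - u s(x, a₃) * u s(y, a₃) := by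
    rw [evN _ (nyx a₃ hya₃.symm), m3]
  -- pairs away from the keys keep their `u`-value
  have away : ∀ e : Sym2 (Fin n), x ∉ e → y ∉ e → v₃ e = u e := by
    intro e hx hy
    have k1 : ∀ c : Fin n, e ≠ s(x, c) := fun c h => hx (h ▸ Sym2.mem_mk_left x c)
    have k2 : ∀ c : Fin n, e ≠ s(y, c) := fun c h => hy (h ▸ Sym2.mem_mk_left y c)
    rw [ev₃ e (k2 a₃) (k1 a₃), ev₂ e (k2 a₂) (k1 a₂), ev₁ e (k2 a₁) (k1 a₁), ev₀ e (k1 y)]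
  have loopy : v₃ s(y, y) = u s(y, y) := by
    rw [ev₃ _ (kyy y a₃ hya₃) (kyx y a₃ hya₃), ev₂ _ (kyy y a₂ hya₂) (kyx y a₂ hya₂), ev₁ _ (kyy y a₁ hya₁) (kyx y a₁ hya₁),
      ev₀ _ (kyxy y hxy.symm)]
  -- the goodness chain
  have hs0 : v₀ s(x, y) = 1 := by rw [hv₀, Function.update_self]
  have hs1 : v₁ s(x, y) = 1 := by rw [ev₁ _ (kxy y a₁ hxa₁) (kxx y a₁ hya₁), hs0]
  have hs2 : v₂ s(x, y) = 1 := by rw [ev₂ _ (kxy y a₂ hxa₂) (kxx y a₂ hya₂), hs1]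
  have hs3 : v₃ s(x, y) = 1 := by rw [ev₃ _ (kxy y a₃ hxa₃) (kxx y a₃ hya₃), hs2]
  have e1 := agood_moveHair_twin v₀ A hA x y a₁ j b hxy hxa₁ hya₁ hs0
  have e2 := agood_moveHair_twin v₁ A hA x y a₂ j b hxy hxa₂ hya₂ hs1
  have e3 := agood_moveHair_twin v₂ A hA x y a₃ j b hxy hxa₃ hya₃ hs2
  have hiso : ∀ z : Fin n, z ≠ y → z ≠ x → v₃ s(y, z) = 0 := by
    intro z hzy hzx
    by_cases h3 : z = a₃
    · subst h3; rw [hv₃, Function.update_of_ne (kyx z z hzy.symm), Function.update_self]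
    rw [ev₃ _ (kyy z a₃ h3) (kyx z a₃ hya₃)]
    by_cases h2 : z = a₂
    · subst h2; rw [hv₂, Function.update_of_ne (kyx z z hzy.symm), Function.update_self]
    rw [ev₂ _ (kyy z a₂ h2) (kyx z a₂ hya₂)]
    by_cases h1 : z = a₁
    · subst h1; rw [hv₁, Function.update_of_ne (kyx z z hzy.symm), Function.update_self]
    rw [ev₁ _ (kyy z a₁ h1) (kyx z a₁ hya₁), ev₀ _ (kyxy z hzx)]
    exact hyN z h1 h2 h3
  have e4 := agood_kill_pendantTwin v₃ A hA j b hxy hyA hjA hby hs3 hiso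
  refine ⟨N, ?_, ?_, ?_, hN1, hN2, hN3, ?_⟩
  · rw [e1, e2, e3, e4, hN, hF]
  · intro z hzx hzP
    simp only [Finset.mem_insert, Finset.mem_singleton, not_or] at hzP
    obtain ⟨hz1, hz2, hz3⟩ := hzP
    by_cases hzy : z = y
    · subst hzy
      rw [hN]
      exact pinW_apply_of_mem_of_not_mem v₃ ⟨Sym2.mem_mk_right x z, by rw [Sym2.mk_isDiag_iff]; exact hxy⟩ (Set.notMem_empty _)
    · rw [evN _ (nyx z hzy), ev₃ _ (kxy z a₃ hxa₃) (kxx z a₃ hz3), ev₂ _ (kxy z a₂ hxa₂) (kxx z a₂ hz2),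
        ev₁ _ (kxy z a₁ hxa₁) (kxx z a₁ hz1), ux z hzy]
      exact hxN z hz1 hz2 hz3
  · rw [evN _ (nyx x hxy), ev₃ _ (kxy x a₃ hxa₃) (kxx x a₃ hxa₃), ev₂ _ (kxy x a₂ hxa₂) (kxx x a₂ hxa₂),
      ev₁ _ (kxy x a₁ hxa₁) (kxx x a₁ hxa₁), ux x hxy]
    exact hxN x hxa₁ hxa₂ hxa₃
  · funext e
    by_cases hx : x ∈ e
    · simp only [hx, if_true]
    simp only [hx, if_false]
    by_cases hy : y ∈ e
    · simp only [hy, if_true]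
      by_cases hd : e.IsDiag
      · -- the loop at `y`
        have he : e = s(y, y) := by
          induction e using Sym2.ind with
          | h p q =>
            have hpq : p = q := Sym2.mk_isDiag_iff.1 hd
            subst hpq
            rcases Sym2.mem_iff.1 hy with h | h <;> rw [← h]
        rw [he, hN, pinW_apply_of_not_mem v₃ ∅ (show s(y, y) ∉ F from fun h => h.2 (Sym2.mk_isDiag_iff.2 rfl)), loopy]
        exact hyN y hya₁ hya₂ hya₃
      · rw [hN]
        exact pinW_apply_of_mem_of_not_mem v₃ ⟨hy, hd⟩ (Set.notMem_empty _)
    · simp only [hy, if_false]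
      rw [evN e hy, away e hx hy]

end KNGoodGC3

end Summit.CriticalPhenomena.PercolationContinuityZ3.Theorems

end
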